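import Summits.QuantumFields.YangMills.Theorems.UnitScaleTiltProp7LemmaHCurvedOfLocalModels
import Summits.QuantumFields.YangMills.Theorems.UnitScaleTiltProp7LocalModelBlendPt
import HarnessLib

/-!
# Route `UnitScaleTilt`, crux K1 «MinimiserStabilityRegPr» (stmt-QuantumFields-19200), route-R E′ path (α′), S3 K-form engine, rows (R4′)∕(H) — FILE 9p₂ (T³ letters):
# LEMMA-H-CURVED WITH FREE LOCAL MODELS, POINTWISE RECENTRING GROUP — ✓p666125 `lemmaH_curved_of_localModels` RESHAPED (routeR-w1 LOCATE (J-δV)(d), 2026-08-28 23:16Z):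
# the third group is `3·d·(24∕ℓ²)²·Σ_y Σ_(z : N y z) Σ_μ ‖Ψ_y(z) − Z_μ(z)‖²` — no sup-type data row `G_y`, no `hG`; `Z_μ(z)` (independent of `y`) is the only datum — so that the junction
# to ★p1 g16's `δ^V(φ₀)` (R5 ⧗p677112 row (H)) is a SUM-type family, bookable by hKg′ rows.  Same `ℓ`-scaling as before (`ℓ^(−4)·Σ_(y,z)` ~ `ℓ^(−4)·ℓ^d·Σ_y`).

Cell `ym3-torus`, D-0154 (3c) twin-width seat `ym-routeR-w1` (gen 6); standing PASS R4′ (★p1 g16 23:01Z).  THEOREMS ONLY (0 `def`, 0 `sorry`); `--supports stmt-QuantumFields-19200`,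
count-neutral.  YM₃ on T³ is a ladder rung (R3), not the Clay problem; nothing here claims a stub, the crux, d = 4 or the gap.

WHAT (ns `…Theorems.Prop7LemmaHCurvedOfLocalModelsPt`): ★★ `sum_sq_norm_lap_localBlend_torus_le_pt`, ★★ `exists_localExtension_lap_energy_le_pt`, ★★★ `lemmaH_curved_of_localModels_pt` —
✓p666125's three theorems with `(G, hG)` removed and the third group replaced as above (✓ `sum_sq_norm_lap_localBlend_le_supp_pt`); everything else VERBATIM.
HONEST SCOPE.  As ✓p666125: the biharmonic Dirichlet principle fed with the blend of arbitrary local models; no estimate of the slack groups.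

References: T. Bałaban, CMP 99 (1985) 389–434 [Balaban1985BackgroundPropagators] ((3.3)–(3.4) pp.390–391, Thm 3.11 p.416); CMP 95 (1984) 17–40 [Balaban1984PropagatorsI]
((1.18) p.20, (1.29)–(1.31) p.23); CMP 102 (1985) 277–309 [Balaban1985Variational] (Prop. 7 p.299).
-/

set_option autoImplicit false

noncomputable section

open scoped BigOperators Matrix.Norms.L2Operator Matrix

namespace Summit.QuantumFields.YangMills.Theorems.Prop7LemmaHCurvedOfLocalModelsPt

open Literature.MathematicalPhysics.QuantumFieldTheory.Balaban1983to89
open Literature.MathematicalPhysics.QuantumFieldTheory.Balaban1983to89.T3ContinuumYM3Torus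
open B9Eq39Adjoint (R covD covDstar divB)
open B9TorusCalculus (torusT torusT_apply torusT_symm_apply)
open B10Eq27TorusAxialLog (unitsField toUField)
open B5Eq118OneStroke (iterBlockOf)
open B15DeterminingSets (embIter)
open Summit.QuantumFields.YangMills.Theorems.Prop7HermiteCardinalWeights (sum_weight_eq_one weight_nonneg weight_le_one weight_embIter)
open Summit.QuantumFields.YangMills.Theorems.Prop7HermiteCornerBlendTorus (weights_vanish_of_far mass_grad_row mass_second_row)
open Summit.QuantumFields.YangMills.Theorems.Prop7LocalModelBlendPt (sum_sq_norm_lap_localBlend_le_supp_pt)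
open Summit.QuantumFields.YangMills.Theorems.Prop7LemmaHCurvedOfLocalModels (abs_diff_weight_le localBlend_embIter)
open Summit.QuantumFields.YangMills.Theorems.Prop7LemmaHCurvedOfRows (profile_rows)
open Summit.QuantumFields.YangMills.Theorems.Prop7PinnedFlatCoercivity (sum_normSq_le_mul_opNorm_sq)
open Summit.QuantumFields.YangMills.Theorems.Prop7CentreBiharmonicDirichlet (lap_energy_le_of_extension_T3)

variable {P : Params} {k : ℕ} (hk : k ≤ P.m + P.K) (h : ZMod (P.sitesPerDir 0)) (p : ℕ → ℝ)

/-! ## §2 The energy of the local-model blend on the fine torus -/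

section Energy

variable {𝔸 : Type} [NormedRing 𝔸] [NormedAlgebra ℝ 𝔸]

include hk

/-- ★★ **THE LOCAL-MODEL BLEND ENERGY ON THE FINE TORUS** (weights discharged; NO hypothesis on the background `U`; local models `Ψ_y` and data row `G` displayed on the support
predicate `∀ ν, y_ν − Q_ν(z) ∈ {−1,0,1,2}`):
`Σ_z‖Δ_UΦ(z)‖² ≤ 3·Σ_yΣ_{z : N y z}‖Δ_UΨ_y(z)‖² + 3·(2d(6∕ℓ))·(3∕ℓ)·Σ_yΣ_{z : N y z}Σ_μ(‖D*_UΨ_y(z,μ)‖² + ‖D_UΨ_y(z,μ)‖²) + 3d²(24∕ℓ²)((24∕ℓ²)ℓ^d)·Σ_yG_y²`.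
[cite: Balaban1985BackgroundPropagators, (3.3)-(3.4) pp.390-391, Thm 3.11 p.416; Balaban1984PropagatorsI, (1.29)-(1.31) p.23] -/
theorem sum_sq_norm_lap_localBlend_torus_le_pt (hp0 : p 0 = 1) (hpℓ : p (P.L ^ k) = 0) (hp01 : ∀ r : ℕ, r < P.L ^ k → 0 ≤ p r ∧ p r ≤ 1)
    (hpS : ∀ r : ℕ, r + 1 ≤ P.L ^ k → |p (r + 1) - p r| ≤ 3 / (((P.L ^ k : ℕ) : ℝ)))
    (hpD : ∀ r : ℕ, 1 ≤ r → r + 1 ≤ P.L ^ k → |p (r + 1) - 2 * p r + p (r - 1)| ≤ 6 / (((P.L ^ k : ℕ) : ℝ)) ^ 2)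
    (hpc : p 1 + p (P.L ^ k - 1) = 1) (hpk : p (P.L ^ k - 1) ≤ 3 / (((P.L ^ k : ℕ) : ℝ)) ^ 2)
    (U : Fin P.d → Site P 0 → 𝔸ˣ) (Ψ : Site P k → Site P 0 → 𝔸) (Z : Fin P.d → Site P 0 → 𝔸) :
    ∑ z : Site P 0, ‖divB (torusT P 0) U (fun μ => covD (torusT P 0) U μ (fun z' => ∑ y : Site P k, (∏ ν : Fin P.d, (p ((z' ν - h).val % P.L ^ k) * (if (iterBlockOf k (fun κ => z' κ - h)) ν = y ν then (1 : ℝ) else 0) + (1 - p ((z' ν - h).val % P.L ^ k)) * (if (iterBlockOf k (fun κ => z' κ - h)) ν + 1 = y ν then (1 : ℝ) else 0))) • Ψ y z')) z‖ ^ 2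
      ≤ 3 * ∑ y : Site P k, ∑ z : Site P 0, (if (∀ ν : Fin P.d, (y ν = (iterBlockOf k (fun κ => z κ - h)) ν - 1 ∨ y ν = (iterBlockOf k (fun κ => z κ - h)) ν ∨ y ν = (iterBlockOf k (fun κ => z κ - h)) ν + 1 ∨ y ν = (iterBlockOf k (fun κ => z κ - h)) ν + 2))
            then ‖divB (torusT P 0) U (fun μ => covD (torusT P 0) U μ (Ψ y)) z‖ ^ 2 else 0)
        + 3 * (2 * (P.d : ℝ) * (6 / (((P.L ^ k : ℕ) : ℝ)))) * (3 / (((P.L ^ k : ℕ) : ℝ)))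
          * ∑ y : Site P k, ∑ z : Site P 0, (if (∀ ν : Fin P.d, (y ν = (iterBlockOf k (fun κ => z κ - h)) ν - 1 ∨ y ν = (iterBlockOf k (fun κ => z κ - h)) ν ∨ y ν = (iterBlockOf k (fun κ => z κ - h)) ν + 1 ∨ y ν = (iterBlockOf k (fun κ => z κ - h)) ν + 2))
            then ∑ μ : Fin P.d, (‖covDstar (torusT P 0) U μ (Ψ y) z‖ ^ 2 + ‖covD (torusT P 0) U μ (Ψ y) z‖ ^ 2) else 0)
        + 3 * ((P.d : ℝ) * (24 / (((P.L ^ k : ℕ) : ℝ)) ^ 2) ^ 2)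
          * ∑ y : Site P k, ∑ z : Site P 0, (if (∀ ν : Fin P.d, (y ν = (iterBlockOf k (fun κ => z κ - h)) ν - 1 ∨ y ν = (iterBlockOf k (fun κ => z κ - h)) ν ∨ y ν = (iterBlockOf k (fun κ => z κ - h)) ν + 1 ∨ y ν = (iterBlockOf k (fun κ => z κ - h)) ν + 2))
            then ∑ μ : Fin P.d, ‖Ψ y z - Z μ z‖ ^ 2 else 0) := by
  have hW1 : ∀ z : Site P 0, ∑ y : Site P k, (∏ ν : Fin P.d, (p ((z ν - h).val % P.L ^ k) * (if (iterBlockOf k (fun κ => z κ - h)) ν = y ν then (1 : ℝ) else 0) + (1 - p ((z ν - h).val % P.L ^ k)) * (if (iterBlockOf k (fun κ => z κ - h)) ν + 1 = y ν then (1 : ℝ) else 0))) = 1 := fun z => sum_weight_eq_one h p z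
  have hW0 : ∀ (y : Site P k) (z : Site P 0), 0 ≤ (∏ ν : Fin P.d, (p ((z ν - h).val % P.L ^ k) * (if (iterBlockOf k (fun κ => z κ - h)) ν = y ν then (1 : ℝ) else 0) + (1 - p ((z ν - h).val % P.L ^ k)) * (if (iterBlockOf k (fun κ => z κ - h)) ν + 1 = y ν then (1 : ℝ) else 0))) := fun y z => weight_nonneg h p hp01 y z
  have hWle : ∀ (y : Site P k) (z : Site P 0), (∏ ν : Fin P.d, (p ((z ν - h).val % P.L ^ k) * (if (iterBlockOf k (fun κ => z κ - h)) ν = y ν then (1 : ℝ) else 0) + (1 - p ((z ν - h).val % P.L ^ k)) * (if (iterBlockOf k (fun κ => z κ - h)) ν + 1 = y ν then (1 : ℝ) else 0))) ≤ 1 := fun y z => weight_le_one h p hp01 y z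
  have hN : ∀ (y : Site P k) (z : Site P 0), ¬ (∀ ν : Fin P.d, (y ν = (iterBlockOf k (fun κ => z κ - h)) ν - 1 ∨ y ν = (iterBlockOf k (fun κ => z κ - h)) ν ∨ y ν = (iterBlockOf k (fun κ => z κ - h)) ν + 1 ∨ y ν = (iterBlockOf k (fun κ => z κ - h)) ν + 2)) →
      (∏ ν : Fin P.d, (p ((z ν - h).val % P.L ^ k) * (if (iterBlockOf k (fun κ => z κ - h)) ν = y ν then (1 : ℝ) else 0) + (1 - p ((z ν - h).val % P.L ^ k)) * (if (iterBlockOf k (fun κ => z κ - h)) ν + 1 = y ν then (1 : ℝ) else 0))) = 0 ∧ (∀ μ : Fin P.d, (∏ ν : Fin P.d, (p (((torusT P 0 μ z) ν - h).val % P.L ^ k) * (if (iterBlockOf k (fun κ => (torusT P 0 μ z) κ - h)) ν = y ν then (1 : ℝ) else 0) + (1 - p (((torusT P 0 μ z) ν - h).val % P.L ^ k)) * (if (iterBlockOf k (fun κ => (torusT P 0 μ z) κ - h)) ν + 1 = y ν then (1 : ℝ) else 0))) = 0) ∧ (∀ μ : Fin P.d, (∏ ν : Fin P.d, (p ((((torusT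 P 0 μ).symm z) ν - h).val % P.L ^ k) * (if (iterBlockOf k (fun κ => ((torusT P 0 μ).symm z) κ - h)) ν = y ν then (1 : ℝ) else 0) + (1 - p ((((torusT P 0 μ).symm z) ν - h).val % P.L ^ k)) * (if (iterBlockOf k (fun κ => ((torusT P 0 μ).symm z) κ - h)) ν + 1 = y ν then (1 : ℝ) else 0))) = 0) := fun y z hfar => weights_vanish_of_far hk h p y z hfar
  have hg₁ := abs_diff_weight_le hk h p hp0 hpℓ hp01 hpS
  have hM1 := mass_grad_row hk h p hp0 hpℓ hp01 hpS
  have hM2 := mass_second_row hk h p hp0 hpℓ hp01 hpD hpc hpk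
  have hG₁ : (0 : ℝ) ≤ 6 / (((P.L ^ k : ℕ) : ℝ)) := by positivity
  have hG₂ : (0 : ℝ) ≤ 24 / (((P.L ^ k : ℕ) : ℝ)) ^ 2 := by positivity
  have hmain := sum_sq_norm_lap_localBlend_le_supp_pt (Y := Site P k) (torusT P 0) U (fun y z => (∏ ν : Fin P.d, (p ((z ν - h).val % P.L ^ k) * (if (iterBlockOf k (fun κ => z κ - h)) ν = y ν then (1 : ℝ) else 0) + (1 - p ((z ν - h).val % P.L ^ k)) * (if (iterBlockOf k (fun κ => z κ - h)) ν + 1 = y ν then (1 : ℝ) else 0)))) hW1 hW0 hWle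
    Ψ (fun y z => ∀ ν : Fin P.d, (y ν = (iterBlockOf k (fun κ => z κ - h)) ν - 1 ∨ y ν = (iterBlockOf k (fun κ => z κ - h)) ν ∨ y ν = (iterBlockOf k (fun κ => z κ - h)) ν + 1 ∨ y ν = (iterBlockOf k (fun κ => z κ - h)) ν + 2))
    hN Z _ _ _ hG₁ hG₂ hg₁ hM1 hM2
  rw [Fintype.card_fin] at hmain
  exact hmain

end Energy

/-! ## §3 Interpolation at the centres (offset `h = (ℓ−1)∕2`) and the extension row -/

section Centre

variable {𝔸 : Type} [NormedRing 𝔸] [NormedAlgebra ℝ 𝔸]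

include hk

omit h in
/-- ★★ **THE EXTENSION ROW FOR LEMMA-H-CURVED WITH FREE LOCAL MODELS**: an extension `Φ` of the centre data `m` with the displayed Laplacian energy exists (the local-model
blend at offset `h = (ℓ−1)∕2`), for ANY local models `Ψ_y` with `Ψ_y(embIter y) = m_y` and ANY data row `G` on the support predicate; the slack is the local models' own
covariant energy on the support. [cite: Balaban1985BackgroundPropagators, (3.3)-(3.4) pp.390-391, Thm 3.11 p.416; Balaban1984PropagatorsI, (1.29)-(1.31) p.23] -/
theorem exists_localExtension_lap_energy_le_pt (hp0 : p 0 = 1) (hpℓ : p (P.L ^ k) = 0) (hp01 : ∀ r : ℕ, r < P.L ^ k → 0 ≤ p r ∧ p r ≤ 1)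
    (hpS : ∀ r : ℕ, r + 1 ≤ P.L ^ k → |p (r + 1) - p r| ≤ 3 / (((P.L ^ k : ℕ) : ℝ)))
    (hpD : ∀ r : ℕ, 1 ≤ r → r + 1 ≤ P.L ^ k → |p (r + 1) - 2 * p r + p (r - 1)| ≤ 6 / (((P.L ^ k : ℕ) : ℝ)) ^ 2)
    (hpc : p 1 + p (P.L ^ k - 1) = 1) (hpk : p (P.L ^ k - 1) ≤ 3 / (((P.L ^ k : ℕ) : ℝ)) ^ 2)
    (U : Fin P.d → Site P 0 → 𝔸ˣ) (m : Site P k → 𝔸) (Ψ : Site P k → Site P 0 → 𝔸) (hΨ : ∀ y : Site P k, Ψ y (embIter k y) = m y)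
    (Z : Fin P.d → Site P 0 → 𝔸) :
    ∃ Φ : Site P 0 → 𝔸, (∀ y : Site P k, Φ (embIter k y) = m y) ∧
      ∑ z : Site P 0, ‖divB (torusT P 0) U (fun μ => covD (torusT P 0) U μ Φ) z‖ ^ 2
        ≤ 3 * ∑ y : Site P k, ∑ z : Site P 0, (if (∀ ν : Fin P.d, (y ν = (iterBlockOf k (fun κ => z κ - ((((P.L ^ k - 1) / 2 : ℕ)) : ZMod (P.sitesPerDir 0)))) ν - 1 ∨ y ν = (iterBlockOf k (fun κ => z κ - ((((P.L ^ k - 1) / 2 : ℕ)) : ZMod (P.sitesPerDir 0)))) ν ∨ y ν = (iterBlockOf k (fun κ => z κ - ((((P.L ^ k - 1) / 2 : ℕ)) : ZMod (P.sitesPerDir 0)))) ν + 1 ∨ y ν = (iterBlockOf k (fun κ => z κ - ((((P.L ^ k - 1) / 2 : ℕ)) : ZMod (P.sitesPerDir 0)))) ν + 2))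
              then ‖divB (torusT P 0) U (fun μ => covD (torusT P 0) U μ (Ψ y)) z‖ ^ 2 else 0)
          + 3 * (2 * (P.d : ℝ) * (6 / (((P.L ^ k : ℕ) : ℝ)))) * (3 / (((P.L ^ k : ℕ) : ℝ)))
            * ∑ y : Site P k, ∑ z : Site P 0, (if (∀ ν : Fin P.d, (y ν = (iterBlockOf k (fun κ => z κ - ((((P.L ^ k - 1) / 2 : ℕ)) : ZMod (P.sitesPerDir 0)))) ν - 1 ∨ y ν = (iterBlockOf k (fun κ => z κ - ((((P.L ^ k - 1) / 2 : ℕ)) : ZMod (P.sitesPerDir 0)))) ν ∨ y ν = (iterBlockOf k (fun κ => z κ - ((((P.L ^ k - 1) / 2 : ℕ)) : ZMod (P.sitesPerDir 0)))) ν + 1 ∨ y ν = (iterBlockOf k (fun κ => z κ - ((((P.L ^ k - 1) / 2 : ℕ)) : ZMod (P.sitesPerDir 0)))) ν + 2))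
              then ∑ μ : Fin P.d, (‖covDstar (torusT P 0) U μ (Ψ y) z‖ ^ 2 + ‖covD (torusT P 0) U μ (Ψ y) z‖ ^ 2) else 0)
          + 3 * ((P.d : ℝ) * (24 / (((P.L ^ k : ℕ) : ℝ)) ^ 2) ^ 2)
            * ∑ y : Site P k, ∑ z : Site P 0, (if (∀ ν : Fin P.d, (y ν = (iterBlockOf k (fun κ => z κ - ((((P.L ^ k - 1) / 2 : ℕ)) : ZMod (P.sitesPerDir 0)))) ν - 1 ∨ y ν = (iterBlockOf k (fun κ => z κ - ((((P.L ^ k - 1) / 2 : ℕ)) : ZMod (P.sitesPerDir 0)))) ν ∨ y ν = (iterBlockOf k (fun κ => z κ - ((((P.L ^ k - 1) / 2 : ℕ)) : ZMod (P.sitesPerDir 0)))) ν + 1 ∨ y ν = (iterBlockOf k (fun κ => z κ - ((((P.L ^ k - 1) / 2 : ℕ)) : ZMod (P.sitesPerDir 0)))) ν + 2))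
              then ∑ μ : Fin P.d, ‖Ψ y z - Z μ z‖ ^ 2 else 0) :=
  ⟨fun z' => ∑ y : Site P k, (∏ ν : Fin P.d, (p ((z' ν - ((((P.L ^ k - 1) / 2 : ℕ)) : ZMod (P.sitesPerDir 0))).val % P.L ^ k) * (if (iterBlockOf k (fun κ => z' κ - ((((P.L ^ k - 1) / 2 : ℕ)) : ZMod (P.sitesPerDir 0)))) ν = y ν then (1 : ℝ) else 0) + (1 - p ((z' ν - ((((P.L ^ k - 1) / 2 : ℕ)) : ZMod (P.sitesPerDir 0))).val % P.L ^ k)) * (if (iterBlockOf k (fun κ => z' κ - ((((P.L ^ k - 1) / 2 : ℕ)) : ZMod (P.sitesPerDir 0)))) ν + 1 = y ν then (1 : ℝ) else 0))) • Ψ y z',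
    fun y => (localBlend_embIter hk p hp0 Ψ y).trans (hΨ y),
    sum_sq_norm_lap_localBlend_torus_le_pt hk ((((P.L ^ k - 1) / 2 : ℕ)) : ZMod (P.sitesPerDir 0)) p hp0 hpℓ hp01 hpS hpD hpc hpk U Ψ Z⟩

end Centre

/-! ## §4 LEMMA-H-curved with free local models (T³ letters) -/

section Assembly

/-- ★★★ **LEMMA-H-CURVED WITH FREE LOCAL MODELS** (T³ letters; see the module docstring): if `Δ_W(Δ_Wψ) = 0` off the `(K−n)`-centres then, for ANY local models `Ψ_y` of
the centre data (`Ψ_y(embIter y) = ψ(embIter y)`) and ANY data row `G` on the support predicate, `L^(K−n)·Σ_x‖Δ_Wψ(x)‖²_HS` is at most `L^(K−n)·2·{` the supported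
covariant Laplacian energy of the `Ψ_y` (× 3) `+` the supported covariant Dirichlet energy of the `Ψ_y` (× `3·(2d·6∕ℓ)·(3∕ℓ)`) `+ 3d²(24∕ℓ²)((24∕ℓ²)ℓ^d)·Σ_yG_y² }`.
[cite: Balaban1985BackgroundPropagators, (3.3)-(3.4) pp.390-391, Thm 3.11 p.416; Balaban1984PropagatorsI, (1.29)-(1.31) p.23; Balaban1985Variational, Prop. 7 p.299] -/
theorem lemmaH_curved_of_localModels_pt (F : T3Family) (K n : ℕ) (hk : K - n ≤ (F.P K).m + (F.P K).K) (hℓ2 : 2 ≤ (F.P K).L ^ (K - n))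
    (W : GaugeField (F.P K) 0 (Matrix.specialUnitaryGroup (Fin 2) ℂ)) (ψ : Site (F.P K) 0 → Matrix (Fin 2) (Fin 2) ℂ)
    (hψ : ∀ x : Site (F.P K) 0, x ∉ Set.range (embIter (K - n)) →
      divB (torusT (F.P K) 0) (fun κ z => unitsField (toUField W) ⟨z, κ⟩) (fun κ y => covD (torusT (F.P K) 0) (fun κ z => unitsField (toUField W) ⟨z, κ⟩) κ
        (fun z => divB (torusT (F.P K) 0) (fun κ z => unitsField (toUField W) ⟨z, κ⟩)
          (fun ν w => covD (torusT (F.P K) 0) (fun κ z => unitsField (toUField W) ⟨z, κ⟩) ν ψ w) z) y) x = 0)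
    (Ψ : Site (F.P K) (K - n) → Site (F.P K) 0 → Matrix (Fin 2) (Fin 2) ℂ) (hΨ : ∀ y, Ψ y (embIter (K - n) y) = ψ (embIter (K - n) y))
    (Z : Fin (F.P K).d → Site (F.P K) 0 → Matrix (Fin 2) (Fin 2) ℂ) :
    (F.L : ℝ) ^ (K - n) * ∑ x : Site (F.P K) 0, ∑ a : Fin 2, ∑ b : Fin 2,
        Complex.normSq ((divB (torusT (F.P K) 0) (fun κ z => unitsField (toUField W) ⟨z, κ⟩)
          (fun κ y => covD (torusT (F.P K) 0) (fun κ z => unitsField (toUField W) ⟨z, κ⟩) κ ψ y) x) a b)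
      ≤ (F.L : ℝ) ^ (K - n) * (2 * (
          3 * ∑ y : Site (F.P K) (K - n), ∑ z : Site (F.P K) 0,
            (if (∀ ν : Fin (F.P K).d,
                (y ν = (iterBlockOf (K - n) (fun κ => z κ - (((((F.P K).L ^ (K - n) - 1) / 2 : ℕ)) : ZMod ((F.P K).sitesPerDir 0)))) ν - 1
                ∨ y ν = (iterBlockOf (K - n) (fun κ => z κ - (((((F.P K).L ^ (K - n) - 1) / 2 : ℕ)) : ZMod ((F.P K).sitesPerDir 0)))) ν
                ∨ y ν = (iterBlockOf (K - n) (fun κ => z κ - (((((F.P K).L ^ (K - n) - 1) / 2 : ℕ)) : ZMod ((F.P K).sitesPerDir 0)))) ν + 1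
                ∨ y ν = (iterBlockOf (K - n) (fun κ => z κ - (((((F.P K).L ^ (K - n) - 1) / 2 : ℕ)) : ZMod ((F.P K).sitesPerDir 0)))) ν + 2))
              then ‖divB (torusT (F.P K) 0) (fun κ z => unitsField (toUField W) ⟨z, κ⟩)
                (fun μ => covD (torusT (F.P K) 0) (fun κ z => unitsField (toUField W) ⟨z, κ⟩) μ (Ψ y)) z‖ ^ 2 else 0)
          + 3 * (2 * ((F.P K).d : ℝ) * (6 / ((((F.P K).L ^ (K - n) : ℕ) : ℝ)))) * (3 / ((((F.P K).L ^ (K - n) : ℕ) : ℝ)))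
            * ∑ y : Site (F.P K) (K - n), ∑ z : Site (F.P K) 0,
              (if (∀ ν : Fin (F.P K).d,
                  (y ν = (iterBlockOf (K - n) (fun κ => z κ - (((((F.P K).L ^ (K - n) - 1) / 2 : ℕ)) : ZMod ((F.P K).sitesPerDir 0)))) ν - 1
                  ∨ y ν = (iterBlockOf (K - n) (fun κ => z κ - (((((F.P K).L ^ (K - n) - 1) / 2 : ℕ)) : ZMod ((F.P K).sitesPerDir 0)))) ν
                  ∨ y ν = (iterBlockOf (K - n) (fun κ => z κ - (((((F.P K).L ^ (K - n) - 1) / 2 : ℕ)) : ZMod ((F.P K).sitesPerDir 0)))) ν + 1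
                  ∨ y ν = (iterBlockOf (K - n) (fun κ => z κ - (((((F.P K).L ^ (K - n) - 1) / 2 : ℕ)) : ZMod ((F.P K).sitesPerDir 0)))) ν + 2))
                then ∑ μ : Fin (F.P K).d,
                  (‖covDstar (torusT (F.P K) 0) (fun κ z => unitsField (toUField W) ⟨z, κ⟩) μ (Ψ y) z‖ ^ 2
                    + ‖covD (torusT (F.P K) 0) (fun κ z => unitsField (toUField W) ⟨z, κ⟩) μ (Ψ y) z‖ ^ 2) else 0)
          + 3 * (((F.P K).d : ℝ) * (24 / ((((F.P K).L ^ (K - n) : ℕ) : ℝ)) ^ 2) ^ 2)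
            * ∑ y : Site (F.P K) (K - n), ∑ z : Site (F.P K) 0,
              (if (∀ ν : Fin (F.P K).d,
                  (y ν = (iterBlockOf (K - n) (fun κ => z κ - (((((F.P K).L ^ (K - n) - 1) / 2 : ℕ)) : ZMod ((F.P K).sitesPerDir 0)))) ν - 1
                  ∨ y ν = (iterBlockOf (K - n) (fun κ => z κ - (((((F.P K).L ^ (K - n) - 1) / 2 : ℕ)) : ZMod ((F.P K).sitesPerDir 0)))) ν
                  ∨ y ν = (iterBlockOf (K - n) (fun κ => z κ - (((((F.P K).L ^ (K - n) - 1) / 2 : ℕ)) : ZMod ((F.P K).sitesPerDir 0)))) ν + 1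
                  ∨ y ν = (iterBlockOf (K - n) (fun κ => z κ - (((((F.P K).L ^ (K - n) - 1) / 2 : ℕ)) : ZMod ((F.P K).sitesPerDir 0)))) ν + 2))
                then ∑ μ : Fin (F.P K).d, ‖Ψ y z - Z μ z‖ ^ 2 else 0))) := by
  obtain ⟨hp0, hpℓ, hp01, hpS, hpD, hpc, hpk⟩ := profile_rows (P := F.P K) (k := K - n) hℓ2
  obtain ⟨Φ, hΦ, hE⟩ := exists_localExtension_lap_energy_le_pt (P := F.P K) (k := K - n) hk _ hp0 hpℓ hp01 hpS hpD hpc hpk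
    (fun κ z => unitsField (toUField W) ⟨z, κ⟩) (fun y => ψ (embIter (K - n) y)) Ψ hΨ Z
  refine lap_energy_le_of_extension_T3 F K n W ψ hψ ⟨Φ, hΦ, mul_le_mul_of_nonneg_left ?_ (by positivity)⟩
  calc ∑ x : Site (F.P K) 0, ∑ a : Fin 2, ∑ b : Fin 2, Complex.normSq ((divB (torusT (F.P K) 0) (fun κ z => unitsField (toUField W) ⟨z, κ⟩)
          (fun κ y => covD (torusT (F.P K) 0) (fun κ z => unitsField (toUField W) ⟨z, κ⟩) κ Φ y) x) a b)
      ≤ ∑ x : Site (F.P K) 0, (2 : ℕ) * ‖divB (torusT (F.P K) 0) (fun κ z => unitsField (toUField W) ⟨z, κ⟩)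
          (fun κ y => covD (torusT (F.P K) 0) (fun κ z => unitsField (toUField W) ⟨z, κ⟩) κ Φ y) x‖ ^ 2 :=
        Finset.sum_le_sum fun x _ => sum_normSq_le_mul_opNorm_sq _
    _ = 2 * ∑ x : Site (F.P K) 0, ‖divB (torusT (F.P K) 0) (fun κ z => unitsField (toUField W) ⟨z, κ⟩)
          (fun μ => covD (torusT (F.P K) 0) (fun κ z => unitsField (toUField W) ⟨z, κ⟩) μ Φ) x‖ ^ 2 := by
        rw [Finset.mul_sum]; push_cast; rfl
    _ ≤ _ := mul_le_mul_of_nonneg_left hE (by norm_num)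

end Assembly

end Summit.QuantumFields.YangMills.Theorems.Prop7LemmaHCurvedOfLocalModelsPt

end
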